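import Mathlib
import Literature.LinearAlgebra.Matrix.UnipotentExpShear

/-!
# `GrenetZeon.DualUnipotentThreeHalves` (stmt-ValiantsHypothesis-24318), R2 heavy-top instrument — PATH CALCULUS ON `𝔫` for LEMMA T2 (d = 2):
# superdiagonal products, the first-order identity for the entry `(A ^ (m−2))_{1,m}`, Jordan chains and the skip-chain witnesses

Experiment cell «val-heavytop-census» (D-0160), engine seat val-htc-eng-2 g6 (MAINTENANCE idle-slot chore, kit 0): kernel port of lead
CENSUS-EXTREMISERS X16 LEMMA T2 — «a codimension-two subspace of `𝔫_m` of nilindex `≤ m − 2` is a coordinate pattern `𝔫_m ∖ {E_{a,a+1}, E_{b,b+1}}`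
with NON-ADJACENT `a, b`» — the triangularisable half of PREREG Q22's conjecture C2.  This file is the entry-level calculus (first of two files;
the classification is `…HeavyTopNilIndexCodimTwo`).  Matrices are `(k+1) × (k+1)`, `x_t = A_{t,t+1}` (`t < k`), `y_i = A_{i,i+2}`.

* `pow_apply_eq_prod_offset` — for `A ∈ 𝔫`: `(A ^ j)_{r, r+j} = ∏_{t<j} x_{r+t}` (paths of displacement `j` in `j` steps are unit-step);
* `pow_succ_apply_long` — the two-term recurrence `(A ^ (j+1))_{0, j+2} = (A ^ j)_{0,j} · y_j + (A ^ j)_{0,j+1} · x_{j+1}`;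
* `pow_apply_long_perturb_*`, ★ `pow_apply_long_perturb` — FIRST-ORDER IDENTITY: if `D` is supported on the two second-superdiagonal positions
  `(c, c+2)` [value `α`] and `(c+1, c+3)` [value `β`], then `((A + D) ^ (c+d+2))_{0, c+d+3} − (A ^ (c+d+2))_{0,c+d+3}
  = (∏_{t<c} x_t) · (β x_c + α x_{c+2}) · ∏_{t<d} x_{c+3+t}` — exact, no higher-order terms (displacement bookkeeping);
* `pow_mulVec_single_of_chain`, `pow_ne_zero_of_chain` — a Jordan chain `A e_{c(i+1)} = e_{c(i)}` of length `L` forces `A ^ L ≠ 0`;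
* `skipChain_*` — the witness `W(p, γ) = Σ_{t ∉ {p−1,p}} E_{t,t+1} + E_{p−1,p+1} + γ E_{p−1,p}` (size `L+2`): strictly upper, `x_p = 0`, `x_{p−1} = γ`,
  `x_t = 1` otherwise, and `W ^ L ≠ 0` (the chain through all indices except `p`).

Honest framing: enemy-side linear algebra for the census instrument; nothing here proves or refutes `HeavyTopLaw`, 24318, S3b or 8062; `VP ≠ VNP` is NOT
proved.  No definitions, no named facts.  [folklore; lead CENSUS-EXTREMISERS X16 LEMMA T2; this cell]
-/

noncomputable section

-- single-conjunct layout: Sub = Summit, duplicated namespace component intended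
set_option linter.dupNamespace false

namespace Summit.ValiantsHypothesis.ValiantsHypothesis.Theorems.GrenetZeon.HeavyTopNilIndexCodimTwoPaths

open Matrix
open Literature.LinearAlgebra.Matrix (IsStrictUpper)

/-! ## Unit-step paths: `(A ^ j)_{r, r+j}` -/

/-- For strictly upper triangular `A` of size `k + 1`: `(A ^ j)_{r, r+j} = ∏_{t<j} A_{r+t, r+t+1}` (`r + j ≤ k`). [folklore] -/
theorem pow_apply_eq_prod_offset {k : ℕ} (A : Matrix (Fin (k + 1)) (Fin (k + 1)) ℂ) (hA : IsStrictUpper A) (r : ℕ) :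
    ∀ (j : ℕ) (hj : r + j ≤ k), (A ^ j) ⟨r, by omega⟩ ⟨r + j, by omega⟩ = ∏ t : Fin j, A ⟨r + t, by omega⟩ ⟨r + t + 1, by omega⟩
  | 0, _ => by simp
  | j + 1, hj => by
    rw [pow_succ, Matrix.mul_apply, Finset.sum_eq_single ⟨r + j, by omega⟩, pow_apply_eq_prod_offset A hA r j (by omega),
      Fin.prod_univ_castSucc]
    · rfl
    · intro l _ hl
      by_cases hlt : (l : ℕ) < r + j
      · rw [hA.pow_apply_eq_zero j _ l (by dsimp only; omega), zero_mul]
      · have hne : (l : ℕ) ≠ r + j := fun h => hl (Fin.ext h)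
        rw [hA l _ (Fin.le_def.2 (by dsimp only; omega)), mul_zero]
    · intro h; exact absurd (Finset.mem_univ _) h

/-! ## One long step: the recurrence for `(A ^ j)_{0, j+1}` -/

/-- The two-term recurrence: `(A ^ (j+1))_{0, j+2} = (A ^ j)_{0,j} · A_{j,j+2} + (A ^ j)_{0,j+1} · A_{j+1,j+2}` for `A ∈ 𝔫` (`j + 2 ≤ k`). [folklore] -/
theorem pow_succ_apply_long {k : ℕ} (A : Matrix (Fin (k + 1)) (Fin (k + 1)) ℂ) (hA : IsStrictUpper A) (j : ℕ) (hj : j + 2 ≤ k) :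
    (A ^ (j + 1)) 0 ⟨j + 2, by omega⟩ =
      (A ^ j) 0 ⟨j, by omega⟩ * A ⟨j, by omega⟩ ⟨j + 2, by omega⟩ +
        (A ^ j) 0 ⟨j + 1, by omega⟩ * A ⟨j + 1, by omega⟩ ⟨j + 2, by omega⟩ := by
  rw [pow_succ, Matrix.mul_apply, Fintype.sum_eq_add (⟨j, by omega⟩ : Fin (k + 1)) ⟨j + 1, by omega⟩ (fun h => by simp [Fin.ext_iff] at h)]
  rintro l ⟨hl1, hl2⟩
  have h1 : (l : ℕ) ≠ j := fun h => hl1 (Fin.ext h)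
  have h2 : (l : ℕ) ≠ j + 1 := fun h => hl2 (Fin.ext h)
  by_cases hlt : (l : ℕ) < j
  · rw [hA.pow_apply_eq_zero j 0 l (by rw [Fin.val_zero]; omega), zero_mul]
  · rw [hA l _ (Fin.le_def.2 (by dsimp only; omega)), mul_zero]

/-! ## The first-order identity for a second-superdiagonal perturbation -/

section Perturb

variable {k : ℕ} (A D : Matrix (Fin (k + 1)) (Fin (k + 1)) ℂ) (hA : IsStrictUpper A) (hD : IsStrictUpper D) (c : ℕ) (α β : ℂ)
  (hDx : ∀ t : ℕ, (ht : t + 1 ≤ k) → D ⟨t, by omega⟩ ⟨t + 1, by omega⟩ = 0)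
  (hDy : ∀ i : ℕ, (hi : i + 2 ≤ k) → i ≠ c → i ≠ c + 1 → D ⟨i, by omega⟩ ⟨i + 2, by omega⟩ = 0)

include hA hD hDx in
/-- The perturbation does not change the unit-step products `(· ^ j)_{0,j}`. -/
theorem pow_apply_diag_perturb (j : ℕ) (hj : j ≤ k) : ((A + D) ^ j) 0 ⟨j, by omega⟩ = (A ^ j) 0 ⟨j, by omega⟩ := by
  have h1 := pow_apply_eq_prod_offset (A + D) (hA.add hD) 0 j (by omega)
  have h2 := pow_apply_eq_prod_offset A hA 0 j (by omega)
  simp only [zero_add] at h1 h2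
  have e0 : (⟨0, by omega⟩ : Fin (k + 1)) = 0 := rfl
  rw [e0] at h1 h2
  rw [h1, h2]
  refine Finset.prod_congr rfl fun t _ => ?_
  rw [Matrix.add_apply, hDx t (by omega), add_zero]

include hA hD hDx hDy in
/-- Phase 1 (`j ≤ c`): below the perturbed positions the long entries agree. -/
theorem pow_apply_long_perturb_low : ∀ (j : ℕ) (hj : j ≤ c) (hjk : j + 1 ≤ k),
    ((A + D) ^ j) 0 ⟨j + 1, by omega⟩ = (A ^ j) 0 ⟨j + 1, by omega⟩
  | 0, _, _ => by simp
  | j + 1, hj, hjk => by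
    rw [pow_succ_apply_long (A + D) (hA.add hD) j (by omega), pow_succ_apply_long A hA j (by omega),
      pow_apply_diag_perturb A D hA hD hDx j (by omega), pow_apply_long_perturb_low j (by omega) (by omega),
      Matrix.add_apply, Matrix.add_apply, hDy j (by omega) (by omega) (by omega), hDx (j + 1) (by omega), add_zero, add_zero]

include hA hD hDx hDy in
/-- Phase 2 (`j = c + 1`): the `α`-term enters. -/
theorem pow_apply_long_perturb_mid (hck : c + 2 ≤ k) (hα : D ⟨c, by omega⟩ ⟨c + 2, by omega⟩ = α) :
    ((A + D) ^ (c + 1)) 0 ⟨c + 2, by omega⟩ =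
      (A ^ (c + 1)) 0 ⟨c + 2, by omega⟩ + (A ^ c) 0 ⟨c, by omega⟩ * α := by
  rw [pow_succ_apply_long (A + D) (hA.add hD) c (by omega), pow_succ_apply_long A hA c (by omega),
    pow_apply_diag_perturb A D hA hD hDx c (by omega), pow_apply_long_perturb_low A D hA hD c hDx hDy c le_rfl (by omega),
    Matrix.add_apply, Matrix.add_apply, hα, hDx (c + 1) (by omega), add_zero]
  ring

include hA hD hDx hDy in
/-- Phase 3 (`j = c + 2 + i`): after the `β`-term enters, the difference is multiplied by the unit steps `x_{c+3}, x_{c+4}, …`. -/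
theorem pow_apply_long_perturb_high (hck : c + 3 ≤ k) (hα : D ⟨c, by omega⟩ ⟨c + 2, by omega⟩ = α)
    (hβ : D ⟨c + 1, by omega⟩ ⟨c + 3, by omega⟩ = β) :
    ∀ (i : ℕ) (hi : c + 3 + i ≤ k),
    ((A + D) ^ (c + 2 + i)) 0 ⟨c + 3 + i, by omega⟩ =
      (A ^ (c + 2 + i)) 0 ⟨c + 3 + i, by omega⟩ +
        ((A ^ (c + 1)) 0 ⟨c + 1, by omega⟩ * β + (A ^ c) 0 ⟨c, by omega⟩ * α * A ⟨c + 2, by omega⟩ ⟨c + 3, by omega⟩) *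
          ∏ t : Fin i, A ⟨c + 3 + t, by omega⟩ ⟨c + 3 + t + 1, by omega⟩
  | 0, hi => by
    have h1 := pow_succ_apply_long (A + D) (hA.add hD) (c + 1) (by omega)
    have h2 := pow_succ_apply_long A hA (c + 1) (by omega)
    have h3 := pow_apply_diag_perturb A D hA hD hDx (c + 1) (by omega)
    have h4 := pow_apply_long_perturb_mid A D hA hD c α hDx hDy (by omega) hα
    have h5 := hDx (c + 2) (by omega)
    simp only [show c + 1 + 1 = c + 2 from rfl, show c + 1 + 2 = c + 3 from rfl] at h1 h2 h5
    simp only [Nat.add_zero, Fin.prod_univ_zero, mul_one]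
    rw [h1, h2, h3, h4, Matrix.add_apply, Matrix.add_apply, hβ, h5, add_zero]
    ring
  | i + 1, hi => by
    have h1 := pow_succ_apply_long (A + D) (hA.add hD) (c + 2 + i) (by omega)
    have h2 := pow_succ_apply_long A hA (c + 2 + i) (by omega)
    have h3 := pow_apply_diag_perturb A D hA hD hDx (c + 2 + i) (by omega)
    have ih := pow_apply_long_perturb_high hck hα hβ i (by omega)
    have h5 := hDy (c + 2 + i) (by omega) (by omega) (by omega)
    have h6 := hDx (c + 3 + i) (by omega)
    simp only [show c + 2 + i + 1 = c + 3 + i by omega, show c + 2 + i + 2 = c + 3 + i + 1 by omega] at h1 h2 h5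
    simp only [show c + 2 + (i + 1) = c + 3 + i by omega, show c + 3 + (i + 1) = c + 3 + i + 1 by omega,
      Fin.prod_univ_castSucc, Fin.val_castSucc, Fin.val_last]
    rw [h1, h2, h3, ih, Matrix.add_apply, Matrix.add_apply, h5, h6, add_zero, add_zero]
    ring

include hA hD hDx hDy in
/-- ★ **First-order identity.**  For `A, D ∈ 𝔫_{k+1}` with `D` vanishing on the superdiagonal and on the second superdiagonal except at `(c, c+2)`
[value `α`] and `(c+1, c+3)` [value `β`], and `k = c + d + 3`:
`((A + D) ^ (c+d+2))_{0,k} = (A ^ (c+d+2))_{0,k} + (∏_{t<c} x_t) · (β x_c + α x_{c+2}) · ∏_{t<d} x_{c+3+t}` (`x_t = A_{t,t+1}`).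
[folklore displacement count; lead EXTREMISERS X16 LEMMA T2 proof «(A^{n−2})_{1n} = Πu_l·(u_{i+1}a_{i−1,i+1} + u_{i−1}a_{i,i+2})»] -/
theorem pow_apply_long_perturb (d : ℕ) (hk : c + d + 3 = k) (hα : D ⟨c, by omega⟩ ⟨c + 2, by omega⟩ = α)
    (hβ : D ⟨c + 1, by omega⟩ ⟨c + 3, by omega⟩ = β) :
    ((A + D) ^ (c + d + 2)) 0 ⟨c + d + 3, by omega⟩ =
      (A ^ (c + d + 2)) 0 ⟨c + d + 3, by omega⟩ +
        (∏ t : Fin c, A ⟨t, by omega⟩ ⟨t + 1, by omega⟩) *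
          (β * A ⟨c, by omega⟩ ⟨c + 1, by omega⟩ + α * A ⟨c + 2, by omega⟩ ⟨c + 3, by omega⟩) *
          ∏ t : Fin d, A ⟨c + 3 + t, by omega⟩ ⟨c + 3 + t + 1, by omega⟩ := by
  have h := pow_apply_long_perturb_high A D hA hD c α β hDx hDy (by omega) hα hβ d (by omega)
  simp only [show c + 2 + d = c + d + 2 by omega, show c + 3 + d = c + d + 3 by omega] at h
  rw [h]
  -- the unit-step products
  have hGc := pow_apply_eq_prod_offset A hA 0 c (by omega)
  have hGc1 := pow_apply_eq_prod_offset A hA 0 (c + 1) (by omega)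
  simp only [zero_add] at hGc hGc1
  have e0 : (⟨0, by omega⟩ : Fin (k + 1)) = 0 := rfl
  rw [e0] at hGc hGc1
  rw [hGc, hGc1, Fin.prod_univ_castSucc]
  simp only [Fin.val_castSucc, Fin.val_last]
  ring

end Perturb

/-! ## Jordan chains -/

/-- A chain `A e_{c(i+1)} = e_{c(i)}` (`i < L`) gives `A ^ L e_{c(L)} = e_{c(0)}`. [folklore] -/
theorem pow_mulVec_single_of_chain {n : ℕ} (A : Matrix (Fin n) (Fin n) ℂ) :
    ∀ (L : ℕ) (c : Fin (L + 1) → Fin n), (∀ i : Fin L, A *ᵥ Pi.single (c i.succ) 1 = Pi.single (c i.castSucc) 1) →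
      A ^ L *ᵥ Pi.single (c (Fin.last L)) 1 = Pi.single (c 0) 1
  | 0, c, _ => by rw [pow_zero, Matrix.one_mulVec]; rfl
  | L + 1, c, h => by
    rw [pow_succ, ← Matrix.mulVec_mulVec, ← Fin.succ_last, h (Fin.last L)]
    exact pow_mulVec_single_of_chain A L (c ∘ Fin.castSucc) fun i => by
      simp only [Function.comp_apply, ← Fin.succ_castSucc]; exact h i.castSucc

/-- A chain of length `L` forces `A ^ L ≠ 0`. [folklore] -/
theorem pow_ne_zero_of_chain {n L : ℕ} (A : Matrix (Fin n) (Fin n) ℂ) (c : Fin (L + 1) → Fin n)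
    (h : ∀ i : Fin L, A *ᵥ Pi.single (c i.succ) 1 = Pi.single (c i.castSucc) 1) : A ^ L ≠ 0 := by
  intro h0
  have h1 := pow_mulVec_single_of_chain A L c h
  rw [h0, Matrix.zero_mulVec] at h1
  have h2 := congrFun h1 (c 0)
  rw [Pi.zero_apply, Pi.single_eq_same] at h2
  exact zero_ne_one h2

/-! ## The skip-chain witnesses `W(p, γ)` -/

section Witness

variable (L p : ℕ) (γ : ℂ)

/-- Entries of the witness `W(p, γ)` of size `L + 2`: `1` at `(t, t+1)` for `t + 1 ≠ p`, `t ≠ p`; `1` at `(p−1, p+1)`; `γ` at `(p−1, p)`. -/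
theorem skipChain_apply (r s : Fin (L + 1 + 1)) :
    (Matrix.of fun r s : Fin (L + 1 + 1) =>
        if (s : ℕ) = r + 1 ∧ (r : ℕ) + 1 ≠ p ∧ (r : ℕ) ≠ p then (1 : ℂ)
        else if (r : ℕ) + 1 = p ∧ (s : ℕ) = p + 1 then 1
        else if (r : ℕ) + 1 = p ∧ (s : ℕ) = p then γ else 0) r s =
      if (s : ℕ) = r + 1 ∧ (r : ℕ) + 1 ≠ p ∧ (r : ℕ) ≠ p then (1 : ℂ)
        else if (r : ℕ) + 1 = p ∧ (s : ℕ) = p + 1 then 1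
        else if (r : ℕ) + 1 = p ∧ (s : ℕ) = p then γ else 0 := rfl

/-- `W(p, γ)` is strictly upper triangular. -/
theorem skipChain_isStrictUpper :
    IsStrictUpper (Matrix.of fun r s : Fin (L + 1 + 1) =>
        if (s : ℕ) = r + 1 ∧ (r : ℕ) + 1 ≠ p ∧ (r : ℕ) ≠ p then (1 : ℂ)
        else if (r : ℕ) + 1 = p ∧ (s : ℕ) = p + 1 then 1
        else if (r : ℕ) + 1 = p ∧ (s : ℕ) = p then γ else 0) := by
  intro r s hsr
  have hsr' : (s : ℕ) ≤ r := hsr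
  rw [Matrix.of_apply, if_neg (by omega), if_neg (by omega), if_neg (by omega)]

/-- The superdiagonal of `W(p, γ)`: `x_t = 1` for `t + 1 ≠ p`, `t ≠ p`. -/
theorem skipChain_superdiag_of_ne (t : Fin (L + 1)) (h1 : (t : ℕ) + 1 ≠ p) (h2 : (t : ℕ) ≠ p) :
    (Matrix.of fun r s : Fin (L + 1 + 1) =>
        if (s : ℕ) = r + 1 ∧ (r : ℕ) + 1 ≠ p ∧ (r : ℕ) ≠ p then (1 : ℂ)
        else if (r : ℕ) + 1 = p ∧ (s : ℕ) = p + 1 then 1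
        else if (r : ℕ) + 1 = p ∧ (s : ℕ) = p then γ else 0) t.castSucc t.succ = 1 := by
  rw [Matrix.of_apply, if_pos ⟨by simp, by simpa using h1, by simpa using h2⟩]

/-- The superdiagonal of `W(p, γ)` at `t = p − 1`: `x_{p−1} = γ`. -/
theorem skipChain_superdiag_pred (t : Fin (L + 1)) (h : (t : ℕ) + 1 = p) :
    (Matrix.of fun r s : Fin (L + 1 + 1) =>
        if (s : ℕ) = r + 1 ∧ (r : ℕ) + 1 ≠ p ∧ (r : ℕ) ≠ p then (1 : ℂ)
        else if (r : ℕ) + 1 = p ∧ (s : ℕ) = p + 1 then 1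
        else if (r : ℕ) + 1 = p ∧ (s : ℕ) = p then γ else 0) t.castSucc t.succ = γ := by
  have h1 : (t.castSucc : ℕ) + 1 = p := by simpa using h
  have h2 : (t.succ : ℕ) = p := by simp; omega
  rw [Matrix.of_apply, if_neg (fun h' => h'.2.1 h1), if_neg (fun h' => by omega), if_pos ⟨h1, h2⟩]

/-- The superdiagonal of `W(p, γ)` at `t = p`: `x_p = 0`. -/
theorem skipChain_superdiag_self (t : Fin (L + 1)) (h : (t : ℕ) = p) :
    (Matrix.of fun r s : Fin (L + 1 + 1) =>
        if (s : ℕ) = r + 1 ∧ (r : ℕ) + 1 ≠ p ∧ (r : ℕ) ≠ p then (1 : ℂ)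
        else if (r : ℕ) + 1 = p ∧ (s : ℕ) = p + 1 then 1
        else if (r : ℕ) + 1 = p ∧ (s : ℕ) = p then γ else 0) t.castSucc t.succ = 0 := by
  have h1 : (t.castSucc : ℕ) = p := by simpa using h
  rw [Matrix.of_apply, if_neg (fun h' => h'.2.2 h1), if_neg (fun h' => by omega), if_neg (fun h' => by omega)]

/-- The chain of `W(p, γ)`: with `c(i) = i` (`i < p`), `c(i) = i + 1` (`i ≥ p`), `W e_{c(i+1)} = e_{c(i)}`. -/
theorem skipChain_chain (i : Fin L) :
    (Matrix.of fun r s : Fin (L + 1 + 1) =>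
        if (s : ℕ) = r + 1 ∧ (r : ℕ) + 1 ≠ p ∧ (r : ℕ) ≠ p then (1 : ℂ)
        else if (r : ℕ) + 1 = p ∧ (s : ℕ) = p + 1 then 1
        else if (r : ℕ) + 1 = p ∧ (s : ℕ) = p then γ else 0) *ᵥ
        Pi.single ((fun i : Fin (L + 1) => (⟨if (i : ℕ) < p then (i : ℕ) else i + 1, by split_ifs <;> omega⟩ : Fin (L + 1 + 1))) i.succ) 1 =
      Pi.single ((fun i : Fin (L + 1) => (⟨if (i : ℕ) < p then (i : ℕ) else i + 1, by split_ifs <;> omega⟩ : Fin (L + 1 + 1))) i.castSucc) 1 := by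
  rw [Matrix.mulVec_single_one]
  funext r
  dsimp only
  rw [Matrix.col_apply, Matrix.of_apply]
  simp only [Pi.single_apply, Fin.ext_iff, Fin.val_succ, Fin.val_castSucc]
  split_ifs <;> first | rfl | (exfalso; omega)

/-- ★ `W(p, γ) ^ L ≠ 0`: the chain through all indices except `p` has length `L`. -/
theorem skipChain_pow_ne_zero :
    (Matrix.of fun r s : Fin (L + 1 + 1) =>
        if (s : ℕ) = r + 1 ∧ (r : ℕ) + 1 ≠ p ∧ (r : ℕ) ≠ p then (1 : ℂ)
        else if (r : ℕ) + 1 = p ∧ (s : ℕ) = p + 1 then 1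
        else if (r : ℕ) + 1 = p ∧ (s : ℕ) = p then γ else 0) ^ L ≠ 0 :=
  pow_ne_zero_of_chain _
    (fun i : Fin (L + 1) => (⟨if (i : ℕ) < p then (i : ℕ) else i + 1, by split_ifs <;> omega⟩ : Fin (L + 1 + 1)))
    (skipChain_chain L p γ)

end Witness

end Summit.ValiantsHypothesis.ValiantsHypothesis.Theorems.GrenetZeon.HeavyTopNilIndexCodimTwoPaths

end
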